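import Summits.Ventures.PercRepro2.CaseOneGadgetUWA1Anchor
import Summits.Ventures.PercRepro2.CaseOneNullEdgeClasses

/-!
# The absent-edge faces of the uwa1 gadget row (blind cell PercRepro2, p1 g29; S5 §2.3, three
degree-`2` classes of the statement vertex closed by `closedAt_of_ext`)

«Every absent-edge face of a closed graph is closed» (`closedAt_of_ext`, p1 g28) applied to the uwa1
gadget anchor (`u ~ {w, a₁}`, `w ~ {u, a₂, o, b}`) with one edge at the hub absent: the statement
vertex `u` of degree `2`, adjacent to the root `a₁` and to an unmarked hub `w` whose other neighbours
are two marks. The three faces (single edges, `w` unmarked): `u ~ {w, a₁}, w ~ {u, a₂, o}` ·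
`u ~ {w, a₁}, w ~ {u, a₂, b}` · `u ~ {w, a₁}, w ~ {u, o, b}`. Each is one null edge away from the
gadget; the faces of the uwob and uwo gadgets are in `CaseOneGadgetFaces`. Own code; standard axioms.
-/

namespace Summit.Ventures.PercRepro2

namespace CaseOne

universe u

section Faces
variable {V : Type*} [Fintype V] [DecidableEq V] {E : Type u} [Fintype E] [DecidableEq E]
  {R : Type*} [Field R] [LinearOrder R] [IsStrictOrderedRing R]
variable {ends : E → Sym2 V} {o a₁ a₂ b u w : V}

/-! ### Faces of the uwa1 gadget -/

/-- **`u ~ {w, a₁}`, `w ~ {u, a₂, o}` is closed**: a null edge `{b, w}` makes it the uwa1 gadget. -/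
theorem closedAt_of_face_uwa1_wa2o {euw eua1 ewa2 ewo : E} (huw : ends euw = s(w, u))
    (hua1 : ends eua1 = s(a₁, u)) (hwa2 : ends ewa2 = s(a₂, w)) (hwo : ends ewo = s(o, w))
    (h_uw_ua1 : euw ≠ eua1) (h_uw_wa2 : euw ≠ ewa2) (h_uw_wo : euw ≠ ewo) (h_ua1_wa2 : eua1 ≠ ewa2)
    (h_ua1_wo : eua1 ≠ ewo) (h_wa2_wo : ewa2 ≠ ewo) (hu : ∀ e, u ∈ ends e → e = euw ∨ e = eua1)
    (hw : ∀ e, w ∈ ends e → e = euw ∨ e = ewa2 ∨ e = ewo) (hwu : w ≠ u) (hou : o ≠ u)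
    (hbu : b ≠ u) (ha1u : a₁ ≠ u) (ha2u : a₂ ≠ u) (ha1w : a₁ ≠ w) (ha2w : a₂ ≠ w) (how : o ≠ w)
    (hbw : b ≠ w) : ClosedAt R o a₁ a₂ b E ends u := by
  refine closedAt_of_ext (s := s(b, w)) (closedAt_of_gadgetUWA1Anchor o a₁ a₂ b _ _ u
    ⟨w, some euw, some eua1, some ewa2, some ewo, none, ?_⟩)
  exact
    { ends_uw := by simp [huw]
      ends_ua1 := by simp [hua1]
      ends_wa2 := by simp [hwa2]
      ends_wo := by simp [hwo]
      ends_wb := rfl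
      ne_uw_ua1 := by simp [h_uw_ua1]
      ne_uw_wa2 := by simp [h_uw_wa2]
      ne_uw_wo := by simp [h_uw_wo]
      ne_uw_wb := by simp
      ne_ua1_wa2 := by simp [h_ua1_wa2]
      ne_ua1_wo := by simp [h_ua1_wo]
      ne_ua1_wb := by simp
      ne_wa2_wo := by simp [h_wa2_wo]
      ne_wa2_wb := by simp
      ne_wo_wb := by simp
      unique_u := by
        intro e he
        cases e with
        | none => exact absurd he (by simp [extEnds, Sym2.mem_iff, hbu.symm, hwu.symm])
        | some e =>
          rcases hu e he with h | h
          · exact Or.inl (by rw [h])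
          · exact Or.inr (by rw [h])
      unique_w := by
        intro e he
        cases e with
        | none => exact Or.inr (Or.inr (Or.inr rfl))
        | some e =>
          rcases hw e he with h | h | h
          · exact Or.inl (by rw [h])
          · exact Or.inr (Or.inl (by rw [h]))
          · exact Or.inr (Or.inr (Or.inl (by rw [h])))
      ne_wu := hwu
      ne_ou := hou
      ne_bu := hbu
      ne_a1u := ha1u
      ne_a2u := ha2u
      ne_a1w := ha1w
      ne_a2w := ha2w
      ne_ow := how
      ne_bw := hbw }

/-- **`u ~ {w, a₁}`, `w ~ {u, a₂, b}` is closed**: a null edge `{o, w}` makes it the uwa1 gadget. -/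
theorem closedAt_of_face_uwa1_wa2b {euw eua1 ewa2 ewb : E} (huw : ends euw = s(w, u))
    (hua1 : ends eua1 = s(a₁, u)) (hwa2 : ends ewa2 = s(a₂, w)) (hwb : ends ewb = s(b, w))
    (h_uw_ua1 : euw ≠ eua1) (h_uw_wa2 : euw ≠ ewa2) (h_uw_wb : euw ≠ ewb) (h_ua1_wa2 : eua1 ≠ ewa2)
    (h_ua1_wb : eua1 ≠ ewb) (h_wa2_wb : ewa2 ≠ ewb) (hu : ∀ e, u ∈ ends e → e = euw ∨ e = eua1)
    (hw : ∀ e, w ∈ ends e → e = euw ∨ e = ewa2 ∨ e = ewb) (hwu : w ≠ u) (hou : o ≠ u)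
    (hbu : b ≠ u) (ha1u : a₁ ≠ u) (ha2u : a₂ ≠ u) (ha1w : a₁ ≠ w) (ha2w : a₂ ≠ w) (how : o ≠ w)
    (hbw : b ≠ w) : ClosedAt R o a₁ a₂ b E ends u := by
  refine closedAt_of_ext (s := s(o, w)) (closedAt_of_gadgetUWA1Anchor o a₁ a₂ b _ _ u
    ⟨w, some euw, some eua1, some ewa2, none, some ewb, ?_⟩)
  exact
    { ends_uw := by simp [huw]
      ends_ua1 := by simp [hua1]
      ends_wa2 := by simp [hwa2]
      ends_wo := rfl
      ends_wb := by simp [hwb]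
      ne_uw_ua1 := by simp [h_uw_ua1]
      ne_uw_wa2 := by simp [h_uw_wa2]
      ne_uw_wo := by simp
      ne_uw_wb := by simp [h_uw_wb]
      ne_ua1_wa2 := by simp [h_ua1_wa2]
      ne_ua1_wo := by simp
      ne_ua1_wb := by simp [h_ua1_wb]
      ne_wa2_wo := by simp
      ne_wa2_wb := by simp [h_wa2_wb]
      ne_wo_wb := by simp
      unique_u := by
        intro e he
        cases e with
        | none => exact absurd he (by simp [extEnds, Sym2.mem_iff, hou.symm, hwu.symm])
        | some e =>
          rcases hu e he with h | h
          · exact Or.inl (by rw [h])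
          · exact Or.inr (by rw [h])
      unique_w := by
        intro e he
        cases e with
        | none => exact Or.inr (Or.inr (Or.inl rfl))
        | some e =>
          rcases hw e he with h | h | h
          · exact Or.inl (by rw [h])
          · exact Or.inr (Or.inl (by rw [h]))
          · exact Or.inr (Or.inr (Or.inr (by rw [h])))
      ne_wu := hwu
      ne_ou := hou
      ne_bu := hbu
      ne_a1u := ha1u
      ne_a2u := ha2u
      ne_a1w := ha1w
      ne_a2w := ha2w
      ne_ow := how
      ne_bw := hbw }

/-- **`u ~ {w, a₁}`, `w ~ {u, o, b}` is closed**: a null edge `{a₂, w}` makes it the uwa1 gadget. -/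
theorem closedAt_of_face_uwa1_wob {euw eua1 ewo ewb : E} (huw : ends euw = s(w, u))
    (hua1 : ends eua1 = s(a₁, u)) (hwo : ends ewo = s(o, w)) (hwb : ends ewb = s(b, w))
    (h_uw_ua1 : euw ≠ eua1) (h_uw_wo : euw ≠ ewo) (h_uw_wb : euw ≠ ewb) (h_ua1_wo : eua1 ≠ ewo)
    (h_ua1_wb : eua1 ≠ ewb) (h_wo_wb : ewo ≠ ewb) (hu : ∀ e, u ∈ ends e → e = euw ∨ e = eua1)
    (hw : ∀ e, w ∈ ends e → e = euw ∨ e = ewo ∨ e = ewb) (hwu : w ≠ u) (hou : o ≠ u)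
    (hbu : b ≠ u) (ha1u : a₁ ≠ u) (ha2u : a₂ ≠ u) (ha1w : a₁ ≠ w) (ha2w : a₂ ≠ w) (how : o ≠ w)
    (hbw : b ≠ w) : ClosedAt R o a₁ a₂ b E ends u := by
  refine closedAt_of_ext (s := s(a₂, w)) (closedAt_of_gadgetUWA1Anchor o a₁ a₂ b _ _ u
    ⟨w, some euw, some eua1, none, some ewo, some ewb, ?_⟩)
  exact
    { ends_uw := by simp [huw]
      ends_ua1 := by simp [hua1]
      ends_wa2 := rfl
      ends_wo := by simp [hwo]
      ends_wb := by simp [hwb]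
      ne_uw_ua1 := by simp [h_uw_ua1]
      ne_uw_wa2 := by simp
      ne_uw_wo := by simp [h_uw_wo]
      ne_uw_wb := by simp [h_uw_wb]
      ne_ua1_wa2 := by simp
      ne_ua1_wo := by simp [h_ua1_wo]
      ne_ua1_wb := by simp [h_ua1_wb]
      ne_wa2_wo := by simp
      ne_wa2_wb := by simp
      ne_wo_wb := by simp [h_wo_wb]
      unique_u := by
        intro e he
        cases e with
        | none => exact absurd he (by simp [extEnds, Sym2.mem_iff, ha2u.symm, hwu.symm])
        | some e =>
          rcases hu e he with h | h
          · exact Or.inl (by rw [h])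
          · exact Or.inr (by rw [h])
      unique_w := by
        intro e he
        cases e with
        | none => exact Or.inr (Or.inl rfl)
        | some e =>
          rcases hw e he with h | h | h
          · exact Or.inl (by rw [h])
          · exact Or.inr (Or.inr (Or.inl (by rw [h])))
          · exact Or.inr (Or.inr (Or.inr (by rw [h])))
      ne_wu := hwu
      ne_ou := hou
      ne_bu := hbu
      ne_a1u := ha1u
      ne_a2u := ha2u
      ne_a1w := ha1w
      ne_a2w := ha2w
      ne_ow := how
      ne_bw := hbw }

end Faces

end CaseOne

end Summit.Ventures.PercRepro2
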